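import Mathlib

/-!
# Window DFT de-bordering

Crux `FeketeSOS.SublinearShadow` (stmt-ValiantsHypothesis-14990), line `Sketch`, stub `stub_windowDFT`
(Bini 1980; Bürgisser–Clausen–Shokrollahi, *Algebraic Complexity Theory*, (15.7) and Prop. 15.26:
"exact algorithms from approximate ones" by interpolation at roots of unity).

Proof idea.  Put `P := Σ_i (c_i).map C * Y_i² ∈ K[X][Π]`.  Its `Π`-degree is `≤ 3v < v + m`, so
`P(Π = C x) = Σ_{n < v+m} P.coeff n * (C x)^n`, while also `P(Π = C x) = Σ_i C(c_i(x)) * Y_i(x, X)²`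
(evaluation is a ring map).  Twisting by `(ζ^k)^{-v}` and summing over `k < m` (a DFT at the primitive
`m`-th root `ζ`) kills every layer `n ≠ v`, `n < v + m` (geometric sum of the non-trivial `m`-th root of
unity `ζ^{n-v}`) and multiplies the layer `n = v` by `m`.  Dividing by the unit `u₀ · m` gives the claimed
weighted sum of the `m · s` specialised squares.
-/

namespace Summit.ValiantsHypothesis.ValiantsHypothesis.Theorems.SublinearShadowSketch

open Polynomial Finset
open scoped BigOperators

-- `Summit.ValiantsHypothesis.ValiantsHypothesis.…` is the tree's mandated single-conjunct layout (Sub = Summit).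
set_option linter.dupNamespace false

/-- **Root-of-unity kernel** with an integer exponent: for a primitive `m`-th root of unity `ζ` and
`l : ℤ`, `Σ_{j<m} (ζ^l)^j = m` if `m ∣ l` and `= 0` otherwise. -/
theorem wdft_kernel (K : Type) [Field K] {m : ℕ} {ζ : K} (hζ : IsPrimitiveRoot ζ m) (l : ℤ) :
    ∑ j ∈ range m, (ζ ^ l) ^ j = if (m : ℤ) ∣ l then (m : K) else 0 := by
  -- adapted from Prior…Gb_ReflectedLocalLaws_GbReflectedLocalLawsCert.GbRLL.kernel_sum (ℕ-exponent, ℂ)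
  by_cases hdvd : (m : ℤ) ∣ l
  · have hone : ζ ^ l = 1 := (hζ.zpow_eq_one_iff_dvd l).mpr hdvd
    rw [if_pos hdvd]
    simp [hone]
  · have hne : ζ ^ l ≠ 1 := fun h => hdvd ((hζ.zpow_eq_one_iff_dvd l).mp h)
    rw [geom_sum_eq hne, if_neg hdvd]
    have hml : (ζ ^ l) ^ m = 1 := by
      rw [← zpow_natCast, ← zpow_mul, mul_comm, zpow_mul, zpow_natCast, hζ.pow_eq_one, one_zpow]
    rw [hml, sub_self, zero_div]

/-- **Only the diagonal layer is resonant**: for `n < v + m` and `v < m`, `m ∣ n - v` (in `ℤ`) iff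
`n = v`. -/
theorem wdft_dvd_iff (v m n : ℕ) (hv : v < m) (hn : n < v + m) :
    ((m : ℤ) ∣ ((n : ℤ) - v)) ↔ n = v := by
  constructor
  · intro h
    have habs : |((n : ℤ) - v)| < (m : ℤ) := by
      rw [abs_sub_lt_iff]; constructor <;> omega
    have := Int.eq_zero_of_abs_lt_dvd h habs
    omega
  · rintro rfl
    simp

/-- **Twisted characters are powers**: `(ζ^k)^{-v} (ζ^k)^n = (ζ^{n-v})^k` (`ζ ≠ 0`). -/
theorem wdft_twist_eq (K : Type) [Field K] (ζ : K) (hζ0 : ζ ≠ 0) (k v n : ℕ) :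
    (ζ ^ k)⁻¹ ^ v * (ζ ^ k) ^ n = (ζ ^ ((n : ℤ) - v)) ^ k := by
  rw [zpow_natCast_sub_natCast₀ hζ0]
  ring

/-- **DFT layer extraction.**  For `P ∈ K[X][Π]` of `Π`-degree `< v + m`, `ζ` a primitive `m`-th root of
unity and `v < m`:  `Σ_{k<m} C((ζ^k)^{-v}) · P(Π = C(ζ^k)) = C(m) · P.coeff v`. -/
theorem wdft_layer (K : Type) [Field K] (v m : ℕ) (ζ : K) (hζ : IsPrimitiveRoot ζ m) (hv : v < m)
    (P : Polynomial (Polynomial K)) (hP : P.natDegree < v + m) :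
    ∑ k ∈ range m, C ((ζ ^ k)⁻¹ ^ v) * P.eval (C (ζ ^ k)) = C (m : K) * P.coeff v := by
  have hζ0 : ζ ≠ 0 := hζ.ne_zero (by omega)
  -- expand `P(Π = C x)` along the digits
  have hexp : ∀ x : K, P.eval (C x) = ∑ n ∈ range (v + m), P.coeff n * C x ^ n :=
    fun x => eval_eq_sum_range' hP _
  simp_rw [hexp, Finset.mul_sum]
  rw [Finset.sum_comm]
  have inner : ∀ n ∈ range (v + m), ∑ k ∈ range m, C ((ζ ^ k)⁻¹ ^ v) * (P.coeff n * C (ζ ^ k) ^ n)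
      = if n = v then C (m : K) * P.coeff n else 0 := by
    intro n hn
    have hn' : n < v + m := Finset.mem_range.mp hn
    calc ∑ k ∈ range m, C ((ζ ^ k)⁻¹ ^ v) * (P.coeff n * C (ζ ^ k) ^ n)
        = C (∑ k ∈ range m, (ζ ^ ((n : ℤ) - v)) ^ k) * P.coeff n := by
          rw [map_sum, Finset.sum_mul]
          refine Finset.sum_congr rfl fun k _ => ?_
          rw [← wdft_twist_eq K ζ hζ0 k v n]
          simp only [map_mul, map_pow]
          ring
      _ = if n = v then C (m : K) * P.coeff n else 0 := by
          rw [wdft_kernel K hζ]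
          by_cases hnv : n = v
          · rw [if_pos ((wdft_dvd_iff v m n hv hn').mpr hnv), if_pos hnv]
          · rw [if_neg (mt (wdft_dvd_iff v m n hv hn').mp hnv), if_neg hnv, map_zero, zero_mul]
  rw [Finset.sum_congr rfl inner, Finset.sum_ite_eq', if_pos (Finset.mem_range.mpr (by omega))]

/-- **Evaluation of the weighted sum of squares** at `Π = C x`:
`(Σ_i (c_i).map C * Y_i²)(C x) = Σ_i C(c_i(x)) * Y_i(C x)²`. -/
theorem wdft_eval (K : Type) [Field K] (s : ℕ) (c : Fin s → Polynomial K)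
    (Y : Fin s → Polynomial (Polynomial K)) (x : K) :
    (∑ i, (c i).map (Polynomial.C : K →+* Polynomial K) * Y i ^ 2).eval (C x)
      = ∑ i, C ((c i).eval x) * ((Y i).eval (C x)) ^ 2 := by
  rw [eval_finsetSum]
  refine Finset.sum_congr rfl fun i _ => ?_
  rw [eval_mul, eval_pow, eval_map, eval₂_at_apply]

/-- **Degree of the weighted sum of squares**: if `deg c_i ≤ v` and `deg_Π Y_i ≤ v` then
`deg_Π (Σ_i (c_i).map C * Y_i²) ≤ 3v`. -/
theorem wdft_natDegree_le (K : Type) [Field K] (s v : ℕ) (c : Fin s → Polynomial K)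
    (Y : Fin s → Polynomial (Polynomial K))
    (hc : ∀ i, (c i).natDegree ≤ v) (hY : ∀ i, (Y i).natDegree ≤ v) :
    (∑ i, (c i).map (Polynomial.C : K →+* Polynomial K) * Y i ^ 2).natDegree ≤ 3 * v := by
  refine natDegree_sum_le_of_forall_le _ _ fun i _ => ?_
  calc ((c i).map (Polynomial.C : K →+* Polynomial K) * Y i ^ 2).natDegree
      ≤ ((c i).map (Polynomial.C : K →+* Polynomial K)).natDegree + (Y i ^ 2).natDegree :=
        natDegree_mul_le
    _ ≤ v + 2 * v :=
        add_le_add (natDegree_map_le.trans (hc i)) (natDegree_pow_le.trans (Nat.mul_le_mul_left 2 (hY i)))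
    _ = 3 * v := by ring

/-- **Window DFT de-bordering** (Bini 1980; Bürgisser–Clausen–Shokrollahi, Algebraic Complexity Theory,
(15.7) and Prop. (15.26)).  Let `ζ ∈ K` be a primitive `m`-th root of unity, `2v < m`, `(m : K) ≠ 0`; let
weights `c_i ∈ K[Π]` and `Y_i ∈ K[X][Π]` have `Π`-degree `≤ v`, and suppose the `Π^v`-layer of
`Σ_i c_i(Π) Y_i(Π, X)²` is `u₀ · F` with `u₀ ≠ 0`.  Then
`F = Σ_{k<m} Σ_i (u₀ m)⁻¹ ζ^{-kv} c_i(ζ^k) · Y_i(ζ^k, X)²`. [folklore] -/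
theorem stub_windowDFT
    (K : Type) [Field K] (s v m : ℕ) (ζ : K) (hζ : IsPrimitiveRoot ζ m) (hm : 2 * v < m) (hmK : (m : K) ≠ 0)
    (c : Fin s → Polynomial K) (Y : Fin s → Polynomial (Polynomial K))
    (hc : ∀ i, (c i).natDegree ≤ v) (hY : ∀ i, (Y i).natDegree ≤ v)
    (F : Polynomial K) (u₀ : K) (hu : u₀ ≠ 0)
    (h : (∑ i, (c i).map (Polynomial.C : K →+* Polynomial K) * Y i ^ 2).coeff v = Polynomial.C u₀ * F) :
    F = ∑ k ∈ range m, ∑ i,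
          Polynomial.C ((u₀ * (m : K))⁻¹ * (ζ ^ k)⁻¹ ^ v * (c i).eval (ζ ^ k)) * ((Y i).eval (C (ζ ^ k))) ^ 2 := by
  set P := ∑ i, (c i).map (Polynomial.C : K →+* Polynomial K) * Y i ^ 2 with hP
  have hdeg : P.natDegree < v + m :=
    lt_of_le_of_lt (wdft_natDegree_le K s v c Y hc hY) (by omega)
  have hDFT := wdft_layer K v m ζ hζ (by omega) P hdeg
  -- pull the constants out of the double sum
  have key : ∑ k ∈ range m, ∑ i,
        Polynomial.C ((u₀ * (m : K))⁻¹ * (ζ ^ k)⁻¹ ^ v * (c i).eval (ζ ^ k)) * ((Y i).eval (C (ζ ^ k))) ^ 2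
      = C ((u₀ * (m : K))⁻¹) * ∑ k ∈ range m, C ((ζ ^ k)⁻¹ ^ v) * P.eval (C (ζ ^ k)) := by
    rw [Finset.mul_sum]
    refine Finset.sum_congr rfl fun k _ => ?_
    rw [hP, wdft_eval, Finset.mul_sum, Finset.mul_sum]
    refine Finset.sum_congr rfl fun i _ => ?_
    simp only [map_mul]
    ring
  have hunit : (u₀ * (m : K))⁻¹ * (m : K) * u₀ = 1 := by
    rw [mul_assoc, mul_comm (m : K) u₀, inv_mul_cancel₀ (mul_ne_zero hu hmK)]
  rw [key, hDFT, h, ← mul_assoc, ← mul_assoc, ← map_mul, ← map_mul, hunit, map_one, one_mul]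

end Summit.ValiantsHypothesis.ValiantsHypothesis.Theorems.SublinearShadowSketch
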